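import Literature.NumberTheory.EllipticCurves.ManinConstantQuadraticTwistAtTwoOrdinaryProofs
import HarnessLib
import HarnessLib.Audit.Tags

/-!
# Candidate E-an-2 of cell `bsd-f2-manin` (D-0131 (3) frontier: the Manin constant at additive
# primes): «`2 ∤ c₀(𝒜)` for every class `𝒜` that is a quadratic twist (`d ∈ {−1, 2, −2}`) of a
# class SEMISTABLE at `2`» (semistability defect `|Φ₂| ≤ 2`) — the UNION of the tree's `η = 1`
# theorem and candidate E-an-1. A `@[conjecture]` leaf (NOTHING asserted; definition only; proved
# edges in the sibling `TwoNotDvdManinOfTwistAtTwoEdges.lean`, which PROVES it equivalent to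
# E-an-1 modulo the landed `η = 1` theorem).

HONEST FRAMING. LENS = analytic / period lattices (planner `bsd-f2-manin-an`, MEMO-an.md §3 «LAW»,
HOME/an/Sketch-an.lean sha16 1b7dcf4617dbd0dd). In local terms: the inertia group at `2` acts on
`T_ℓ 𝒜` through a group of order `≤ 2` (`W.semistabilityDefectAt 2 ≤ 2`, tree
`Literature/NumberTheory/EllipticCurves/SemistabilityDefect.lean`) ⟹ `ord₂ c₀(𝒜) = 0`; the bridge
«`e₂ ≤ 2` ⟺ `𝒜` is a twist by `d ∈ {−1, ±2}` of a class semistable at `2`» is NOT in the tree, so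
the law is stated in the twist form, VERBATIM the planner's sketch = the displayed binders of
`not_dvd_maninConstant_of_isTwistOfSemistableAtTwo_etaOne_gamma0` with `hη` DELETED. Said openly
(memo §6): the `η = 1` part is a tree THEOREM (refuter-1 T5-twist TRIVIAL); the beyond-print content
is exactly E-an-1 (edge file: E-an-2 ⟺ E-an-1 given the landed theorem). BC5 WITNESS:
HOME/an/twistlattice-rows.tsv.gz 8048591e49d09b2f, all 21 273 `q = 2` rows (partner semistable at
`2`); beyond-print = the `η = 2` rows (7 042 classes); violations 0. Refuter verdicts: REF1 **SURVIVES**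
2026-08-27T14:02Z (HOME/REFUTER-ref1.md §R1.10: = the landed η = 1 theorem ∨ E-an-1; crux probes
CLEAN); REF2 pending at filing.
-/

noncomputable section

open scoped MatrixGroups ModularForm

open CongruenceSubgroup WeierstrassCurve
  Literature.NumberTheory.EllipticCurves Literature.NumberTheory.EllipticCurves.ModularForms

namespace Summit.BirchSwinnertonDyer.Rank1Residual.ManinAdditive

/-- **Candidate E-an-2 `TwoNotDvdManinOfTwistOfSemistableAtTwo` (cell bsd-f2-manin; OPEN as a
whole because of its `η = 2` part, nothing asserted):** modulo the by-name Manin facts, for elliptic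
`W ~ W′ ⊗ χ_d` with `d ∈ {−1, 2, −2}`, `W′` globally minimal and SEMISTABLE at `2`
(`4 ∤ N(W′)`), `N(W′) ∣ N(W)`, `(4|d|)² ∣ N(W)`, `W` additive at `2`: every lattice-optimal datum `D₀`
of every globally minimal `W₀ ~ W` has `2 ∤ D₀.maninConstant`. = the tree theorem
`not_dvd_maninConstant_of_isTwistOfSemistableAtTwo_etaOne_gamma0` with its clause
`hη : d = -1 ∨ 2 ∣ N(W′) ∨ Odd (a₂(W′))` deleted.
[cite: Stevens1989, Lemma (5.4) and §5 (shape only: printed for η = 1; the η-free law is NOT in print — cell bsd-f2-manin MEMO-an.md §3)] -/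
@[conjecture] def TwoNotDvdManinOfTwistOfSemistableAtTwo : Prop :=
  ∀ (_hM : mazur_not_dvd_maninConstant_of_odd)
    (_hAU : abbesUllmo_not_dvd_maninConstant_of_not_dvd_level)
    (_hC2 : cesnavicius_not_two_dvd_maninConstant_of_two_dvd_level) (_hnf : exists_isNewformOf)
    {W : WeierstrassCurve ℚ} [W.IsElliptic] {W' : WeierstrassCurve ℚ} [W'.IsElliptic]
    [W'.IsGloballyMinimal] {d : ℤ} (_hd : d = -1 ∨ d = 2 ∨ d = -2)
    (_htw : IsIsogenous W (W'.quadraticTwist (d : ℚ)))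
    (_hN'N : W'.conductorNorm ℤ ∣ W.conductorNorm ℤ)
    (_hmN : (4 * d.natAbs) ^ 2 ∣ W.conductorNorm ℤ)
    (_h4N' : ¬ 2 ^ 2 ∣ W'.conductorNorm ℤ)
    (_hadd : ¬ W.HasGoodReductionAtPrime 2 ∧ ¬ W.HasMultiplicativeReductionAtPrime 2)
    (W₀ : WeierstrassCurve ℚ) [W₀.IsElliptic] [W₀.IsGloballyMinimal] {N₀ : ℕ} [NeZero N₀]
    (D₀ : ModularParametrizationData W₀ N₀) (_hiso : IsIsogenous W W₀)
    (_h₀ : ∀ z ∈ D₀.L.lattice, ∃ w ∈ periodLattice D₀.f, z = D₀.c * w),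
    ¬ (2 : ℤ) ∣ D₀.maninConstant

end Summit.BirchSwinnertonDyer.Rank1Residual.ManinAdditive

end
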